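import Summits.Parity.GeneralizedHardyLittlewood.Theorems.LiouvilleShiftedTablesSieveToMAvgTypeIIReduce
import Summits.Parity.GeneralizedHardyLittlewood.Theorems.LiouvilleShiftedTablesSieveToMAvgOpNorm

/-!
# Sieve glue for `SieveToMAvg`, part 6b: Type II — the main pieces through the dilated tables

Support file for item stmt-Parity-14274 (route `LiouvilleShiftedTables`).  The main piece
`main_{k,q}` of part 6a (rows `a` in the fine box `(lo, (1+Δ₁)lo]`, columns `b` with `x/lo < b ≤ 2x/hi`,
congruence `ab ≡ h (mod q)`, `(q,h) = 1`) is block-diagonal over the reduced classes `u` of `a`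
(`b ≡ h ū`), each block being a bilinear form in the class-restricted shifted multiplication table
`M^{(q;u,v)}_{ab} = λ(ab − h)` of the crux `DilatedTableChowla` at `A = lo`.  By part 5,

  `|main_{k,q}| ≤ ‖α_k‖₂ ‖β‖₂ · F*(q)^{1/4}`,  `F*(q) = max_{u,v} tr (M Mᵀ)²`,

and Hölder over `q` against the `ℓ¹`-form `∑_q q³ F ≤ X²/(log X)^C` of the crux (`HypII`, the crux at
a fixed scale `X`) gives `∑_q |main_{k,q}| ≤ ‖α_k‖ ‖β‖ (X²/(log X)^C)^{1/4} (∑_{q≤Q} 1/q)^{3/4}`;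
finally `∑_k ‖α_k‖ ≤ √K₁ ‖α‖`.
-/

namespace Summit.Parity.GeneralizedHardyLittlewood.Theorems.SieveToMAvg

open Finset Real
open scoped ArithmeticFunction.zeta ArithmeticFunction.sigma
open Literature.NumberTheory.Sieve.BFI

/-! ### The Type-II hypothesis at a fixed scale -/

/-- The fourth moment `tr (M Mᵀ)²` of the class-restricted table of `DilatedTableChowla`:
rows `a, a' ∈ (⌊A⌋, ⌊2A⌋]` with `a ≡ a' ≡ u (q)`, columns `b ≤ X/A` with `b ≡ v (q)`, entries
`λ(ab + c)`. [folklore] -/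
noncomputable def tableF (X : ℝ) (c : ℤ) (q : ℕ) (A : ℝ) (u v : ℕ) : ℝ :=
  ∑ a ∈ (Ioc ⌊A⌋₊ ⌊2 * A⌋₊).filter (fun a : ℕ => a ≡ u [MOD q]),
    ∑ a' ∈ (Ioc ⌊A⌋₊ ⌊2 * A⌋₊).filter (fun a' : ℕ => a' ≡ u [MOD q]),
      (∑ b ∈ (Icc 1 ⌊X / A⌋₊).filter (fun b : ℕ => b ≡ v [MOD q]),
        (ArithmeticFunction.liouville (Int.toNat ((a : ℤ) * b + c)) : ℝ) *
          (ArithmeticFunction.liouville (Int.toNat ((a' : ℤ) * b + c)) : ℝ)) ^ 2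

/-- `DilatedTableChowla` at the fixed shift `c`, window `δ`, exponent `C` and scale `X`:
`∀ A ∈ [X^δ, X^{1/3+δ}] ∀ u v, ∑_{q ≤ X^{δ/2}} q³ tableF(q, A, u q, v q) ≤ X²/(log X)^C`. [folklore] -/
def HypII (X : ℝ) (c : ℤ) (δ C : ℝ) : Prop :=
  ∀ A : ℝ, X ^ δ ≤ A → A ≤ X ^ (1 / 3 + δ) → ∀ u v : ℕ → ℕ,
    (∑ q ∈ Icc 1 ⌊X ^ (δ / 2)⌋₊, (q : ℝ) ^ 3 * tableF X c q A (u q) (v q)) ≤ X ^ 2 / Real.log X ^ C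

/-- `tableF ≥ 0`. [folklore] -/
theorem tableF_nonneg (X : ℝ) (c : ℤ) (q : ℕ) (A : ℝ) (u v : ℕ) : 0 ≤ tableF X c q A u v :=
  Finset.sum_nonneg fun _ _ => Finset.sum_nonneg fun _ _ => sq_nonneg _

/-- The table entry `λ(ab + c)` as a matrix. [folklore] -/
noncomputable def tabM (c : ℤ) (a b : ℕ) : ℝ :=
  (ArithmeticFunction.liouville (Int.toNat ((a : ℤ) * b + c)) : ℝ)

/-- `tableF` is the `fourthMoment` of part 5 for the class-restricted index sets. [folklore] -/
theorem tableF_eq_fourthMoment (X : ℝ) (c : ℤ) (q : ℕ) (A : ℝ) (u v : ℕ) :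
    tableF X c q A u v =
      fourthMoment ((Ioc ⌊A⌋₊ ⌊2 * A⌋₊).filter (fun a : ℕ => a ≡ u [MOD q]))
        ((Icc 1 ⌊X / A⌋₊).filter (fun b : ℕ => b ≡ v [MOD q])) (tabM c) := rfl

/-- With `c = −h`, the table entry is the weight of part 6a: `tabM (−h) a b = λ(ab − h)`. [folklore] -/
theorem tabM_neg_eq_lamW (h a b : ℕ) : tabM (-(h : ℤ)) a b = lamW h (a * b) := by
  unfold tabM lamW
  push_cast
  ring_nf

/-- The maximal fourth moment over the classes: `F*(q) = max_{u, v < q} tableF(q, A, u, v)`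
(and `0` for `q = 0`). [folklore] -/
noncomputable def Fstar (X : ℝ) (c : ℤ) (q : ℕ) (A : ℝ) : ℝ :=
  if hq : 0 < q then
    ((Finset.range q) ×ˢ (Finset.range q)).sup' ⟨(0, 0), by simp [hq]⟩ (fun p => tableF X c q A p.1 p.2)
  else 0

/-- `tableF(q, A, u, v) ≤ F*(q)` for `u, v < q`. [folklore] -/
theorem tableF_le_Fstar (X : ℝ) (c : ℤ) {q : ℕ} (A : ℝ) {u v : ℕ} (hu : u < q) (hv : v < q) :
    tableF X c q A u v ≤ Fstar X c q A := by
  have hq : 0 < q := by omega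
  unfold Fstar
  rw [dif_pos hq]
  exact Finset.le_sup' (fun p : ℕ × ℕ => tableF X c q A p.1 p.2) (by simp [hu, hv] : (u, v) ∈ (Finset.range q) ×ˢ (Finset.range q))

/-- `F*(q) ≥ 0`. [folklore] -/
theorem Fstar_nonneg (X : ℝ) (c : ℤ) (q : ℕ) (A : ℝ) : 0 ≤ Fstar X c q A := by
  rcases Nat.eq_zero_or_pos q with hq | hq
  · subst hq; unfold Fstar; simp
  · exact (tableF_nonneg X c q A 0 0).trans (tableF_le_Fstar X c A hq hq)

/-- `F*(q)` is attained: there are `u*, v* < q` with `F*(q) = tableF(q, A, u*, v*)` (`q ≥ 1`). [folklore] -/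
theorem exists_Fstar_eq (X : ℝ) (c : ℤ) {q : ℕ} (hq : 0 < q) (A : ℝ) :
    ∃ u v : ℕ, u < q ∧ v < q ∧ Fstar X c q A = tableF X c q A u v := by
  unfold Fstar
  rw [dif_pos hq]
  obtain ⟨p, hp, hpeq⟩ := Finset.exists_mem_eq_sup' (⟨(0, 0), by simp [hq]⟩ :
    ((Finset.range q) ×ˢ (Finset.range q)).Nonempty) (fun p : ℕ × ℕ => tableF X c q A p.1 p.2)
  rw [Finset.mem_product, Finset.mem_range, Finset.mem_range] at hp
  exact ⟨p.1, p.2, hp.1, hp.2, hpeq⟩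

/-- **Hölder against the crux**: under `HypII X c δ C`, for `X^δ ≤ A ≤ X^{1/3+δ}` and `Q ≤ ⌊X^{δ/2}⌋`,
`∑_{q ∈ s} F*(q)^{1/4} ≤ (X²/(log X)^C)^{1/4} (∑_{q ≤ Q} 1/q)^{3/4}` for every `s ⊆ [1, Q]`. [folklore] -/
theorem sum_Fstar_rpow_le {X : ℝ} {c : ℤ} {δ C : ℝ} (hyp : HypII X c δ C) (hX : 1 ≤ X) {A : ℝ} (hA1 : X ^ δ ≤ A)
    (hA2 : A ≤ X ^ (1 / 3 + δ)) {Q : ℕ} (hQ : Q ≤ ⌊X ^ (δ / 2)⌋₊) {s : Finset ℕ} (hs : s ⊆ Icc 1 Q) :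
    ∑ q ∈ s, Fstar X c q A ^ ((1 : ℝ) / 4) ≤
      (X ^ 2 / Real.log X ^ C) ^ ((1 : ℝ) / 4) * (∑ q ∈ Icc 1 Q, (q : ℝ)⁻¹) ^ ((3 : ℝ) / 4) := by
  classical
  -- maximising classes as functions of `q`
  have hch : ∀ q : ℕ, ∃ uv : ℕ × ℕ, 0 < q → uv.1 < q ∧ uv.2 < q ∧ Fstar X c q A = tableF X c q A uv.1 uv.2 := by
    intro q
    rcases Nat.eq_zero_or_pos q with hq | hq
    · exact ⟨(0, 0), fun h => absurd h (by omega)⟩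
    · obtain ⟨u, v, hu, hv, he⟩ := exists_Fstar_eq X c hq A
      exact ⟨(u, v), fun _ => ⟨hu, hv, he⟩⟩
  choose uv huv using hch
  have hs1 : ∀ q ∈ s, 1 ≤ q := fun q hq => (Finset.mem_Icc.1 (hs hq)).1
  -- Hölder
  have hH := sum_le_holder_cube s hs1 (fun q => Fstar X c q A ^ ((1 : ℝ) / 4))
    (fun q _ => Real.rpow_nonneg (Fstar_nonneg X c q A) _)
  refine hH.trans ?_
  have h4 : ∀ q ∈ s, (Fstar X c q A ^ ((1 : ℝ) / 4)) ^ 4 = Fstar X c q A := by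
    intro q _
    rw [← Real.rpow_natCast, ← Real.rpow_mul (Fstar_nonneg X c q A)]
    norm_num
  have hsum : ∑ q ∈ s, (q : ℝ) ^ 3 * (Fstar X c q A ^ ((1 : ℝ) / 4)) ^ 4 ≤ X ^ 2 / Real.log X ^ C := by
    rw [Finset.sum_congr rfl fun q hq => by rw [h4 q hq]]
    calc ∑ q ∈ s, (q : ℝ) ^ 3 * Fstar X c q A
        = ∑ q ∈ s, (q : ℝ) ^ 3 * tableF X c q A (uv q).1 (uv q).2 := by
          refine Finset.sum_congr rfl fun q hq => ?_
          rw [(huv q (hs1 q hq)).2.2]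
      _ ≤ ∑ q ∈ Icc 1 ⌊X ^ (δ / 2)⌋₊, (q : ℝ) ^ 3 * tableF X c q A (uv q).1 (uv q).2 := by
          refine Finset.sum_le_sum_of_subset_of_nonneg (hs.trans ?_) fun q _ _ => ?_
          · exact fun q hq => by rw [Finset.mem_Icc] at hq ⊢; omega
          · exact mul_nonneg (by positivity) (tableF_nonneg X c q A _ _)
      _ ≤ X ^ 2 / Real.log X ^ C := hyp A hA1 hA2 (fun q => (uv q).1) (fun q => (uv q).2)
  have hinv : ∑ q ∈ s, (q : ℝ)⁻¹ ≤ ∑ q ∈ Icc 1 Q, (q : ℝ)⁻¹ :=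
    Finset.sum_le_sum_of_subset_of_nonneg hs fun q _ _ => by positivity
  have hnn : 0 ≤ ∑ q ∈ s, (q : ℝ) ^ 3 * (Fstar X c q A ^ ((1 : ℝ) / 4)) ^ 4 :=
    Finset.sum_nonneg fun q _ => by positivity
  have hnn' : 0 ≤ ∑ q ∈ s, (q : ℝ)⁻¹ := Finset.sum_nonneg fun q _ => by positivity
  have hX0 : 0 ≤ X ^ 2 / Real.log X ^ C :=
    div_nonneg (pow_nonneg (by linarith) 2) (Real.rpow_nonneg (Real.log_nonneg hX) C)
  have hX0' : 0 ≤ (X ^ 2 / Real.log X ^ C) ^ ((1 : ℝ) / 4) := Real.rpow_nonneg hX0 _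
  gcongr

/-! ### The reduced classes and the inverse residue `v(u) = h ū` -/

/-- The residue `v(u) ≡ h u⁻¹ (mod q)` as a natural number `< q` (`q ≥ 1`). [folklore] -/
noncomputable def vRes (h q u : ℕ) : ℕ := ((h : ZMod q) * ((u : ZMod q)⁻¹)).val

/-- `v(u) < q` for `q ≥ 1`. [folklore] -/
theorem vRes_lt {h q : ℕ} (hq : 0 < q) (u : ℕ) : vRes h q u < q := by
  haveI : NeZero q := ⟨hq.ne'⟩
  exact ZMod.val_lt _

/-- `u · v(u) ≡ h (mod q)` for `(u, q) = 1`, `q ≥ 1`. [folklore] -/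
theorem mul_vRes_modEq {h q u : ℕ} (hq : 0 < q) (hu : Nat.Coprime u q) : u * vRes h q u ≡ h [MOD q] := by
  haveI : NeZero q := ⟨hq.ne'⟩
  rw [← ZMod.natCast_eq_natCast_iff]
  unfold vRes
  push_cast
  rw [ZMod.natCast_zmod_val, mul_comm ((h : ZMod q)) _, ← mul_assoc, ZMod.coe_mul_inv_eq_one u hu, one_mul]

/-- `v` is injective on the reduced residues `u < q` when `(h, q) = 1`. [folklore] -/
theorem vRes_injOn {h q : ℕ} (hq : 0 < q) (hh : Nat.Coprime h q) :
    Set.InjOn (vRes h q) {u : ℕ | u < q ∧ Nat.Coprime u q} := by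
  haveI : NeZero q := ⟨hq.ne'⟩
  intro u hu u' hu' heq
  obtain ⟨hul, huc⟩ := hu
  obtain ⟨hul', huc'⟩ := hu'
  unfold vRes at heq
  have heq' := ZMod.val_injective q heq
  -- multiply by `h⁻¹` on the left and by `u`, `u'`
  have hunit : (h : ZMod q) * ((h : ZMod q)⁻¹) = 1 := ZMod.coe_mul_inv_eq_one h hh
  have hinv : ((u : ZMod q)⁻¹) = ((u' : ZMod q)⁻¹) := by
    have := congrArg (fun z => ((h : ZMod q)⁻¹) * z) heq'
    rwa [← mul_assoc, ← mul_assoc, mul_comm ((h : ZMod q)⁻¹), hunit, one_mul, one_mul] at this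
  have huu : (u : ZMod q) = (u' : ZMod q) := by
    have h1 : (u : ZMod q) * ((u : ZMod q)⁻¹) = 1 := ZMod.coe_mul_inv_eq_one u huc
    have h2 : (u' : ZMod q) * ((u' : ZMod q)⁻¹) = 1 := ZMod.coe_mul_inv_eq_one u' huc'
    calc (u : ZMod q) = (u : ZMod q) * ((u' : ZMod q) * ((u' : ZMod q)⁻¹)) := by rw [h2, mul_one]
      _ = (u : ZMod q) * ((u : ZMod q)⁻¹) * (u' : ZMod q) := by rw [hinv]; ring
      _ = (u' : ZMod q) := by rw [h1, one_mul]
  rw [ZMod.natCast_eq_natCast_iff', Nat.mod_eq_of_lt hul, Nat.mod_eq_of_lt hul'] at huu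
  exact huu

/-- **The congruence `ab ≡ h (q)` through the class of `a`**: for `q ≥ 1`, `(h, q) = 1`,
`1_{ab ≡ h (q)} = ∑_{u < q, (u,q)=1} 1_{a ≡ u (q)} 1_{b ≡ v(u) (q)}`. [folklore] -/
theorem indicator_modEq_eq_sum {h q : ℕ} (hq : 0 < q) (hh : Nat.Coprime h q) (a b : ℕ) (t : ℝ) :
    (if a * b ≡ h [MOD q] then t else 0) =
      ∑ u ∈ (Finset.range q).filter (fun u => Nat.Coprime u q),
        if a ≡ u [MOD q] ∧ b ≡ vRes h q u [MOD q] then t else 0 := by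
  classical
  set u₀ := a % q with hu₀
  have hu₀lt : u₀ < q := Nat.mod_lt a hq
  have hau₀ : a ≡ u₀ [MOD q] := (Nat.mod_modEq a q).symm
  -- any admissible `u` is `u₀`
  have huniq : ∀ u ∈ (Finset.range q).filter (fun u => Nat.Coprime u q), a ≡ u [MOD q] → u = u₀ := by
    intro u hu hau
    rw [Finset.mem_filter, Finset.mem_range] at hu
    have : u % q = a % q := hau.symm
    rw [Nat.mod_eq_of_lt hu.1] at this
    exact this
  by_cases hab : a * b ≡ h [MOD q]
  · rw [if_pos hab]
    -- `(a, q) = 1`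
    have hcop : Nat.Coprime u₀ q := by
      -- `gcd a q ∣ h` and `gcd a q ∣ q`, and `(h, q) = 1`
      have h1 : Nat.gcd a q ∣ q := Nat.gcd_dvd_right a q
      have h2 : Nat.gcd a q ∣ h := by
        have hd : Nat.gcd a q ∣ a * b := dvd_mul_of_dvd_left (Nat.gcd_dvd_left a q) b
        exact (Nat.ModEq.dvd_iff hab h1).1 hd
      have hga : Nat.gcd a q = 1 := Nat.Coprime.eq_one_of_dvd (Nat.Coprime.coprime_dvd_left h2 hh) h1
      show Nat.gcd (a % q) q = 1
      rw [show Nat.gcd (a % q) q = Nat.gcd q a from (Nat.gcd_rec q a).symm, Nat.gcd_comm]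
      exact hga
    have hmem : u₀ ∈ (Finset.range q).filter (fun u => Nat.Coprime u q) := by
      rw [Finset.mem_filter, Finset.mem_range]; exact ⟨hu₀lt, hcop⟩
    rw [Finset.sum_eq_single_of_mem u₀ hmem]
    · rw [if_pos]
      refine ⟨hau₀, ?_⟩
      -- `u₀ b ≡ a b ≡ h ≡ u₀ v(u₀)`, cancel the unit `u₀`
      have h1 : u₀ * b ≡ h [MOD q] := (Nat.ModEq.mul_right b hau₀).symm.trans hab
      have h2 : u₀ * vRes h q u₀ ≡ h [MOD q] := mul_vRes_modEq hq hcop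
      exact Nat.ModEq.cancel_left_of_coprime (by rwa [Nat.coprime_comm] at hcop) (h1.trans h2.symm)
    · intro u hu hne
      rw [if_neg]
      rintro ⟨hau, -⟩
      exact hne (huniq u hu hau)
  · rw [if_neg hab]
    symm
    refine Finset.sum_eq_zero fun u hu => ?_
    rw [if_neg]
    rintro ⟨hau, hbv⟩
    apply hab
    have hcop : Nat.Coprime u q := (Finset.mem_filter.1 hu).2
    calc a * b ≡ u * vRes h q u [MOD q] := Nat.ModEq.mul hau hbv
      _ ≡ h [MOD q] := mul_vRes_modEq hq hcop

end Summit.Parity.GeneralizedHardyLittlewood.Theorems.SieveToMAvg
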